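import Summits.Parity.GeneralizedHardyLittlewood.Theorems.BeyondDiagonalBeatsQuarter.OffDiagCoreLevelsTruncMono
import Summits.Parity.GeneralizedHardyLittlewood.Theorems.BeyondDiagonalBeatsQuarter.OffDiagCoreLevelsTrunc
import Summits.Parity.GeneralizedHardyLittlewood.Theorems.BeyondDiagonalBeatsQuarter.OffDiagPrincipalLevelScales
import Summits.Parity.GeneralizedHardyLittlewood.Theorems.BeyondDiagonalBeatsQuarter.OffDiagLargeConductorScales
import Summits.Parity.GeneralizedHardyLittlewood.Theorems.BeyondDiagonalBeatsQuarter.OffDiagGoodPrimesDense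
import Summits.Parity.GeneralizedHardyLittlewood.Theorems.BeyondDiagonalBeatsQuarter.OffDiagTailsMollified
import HarnessLib

/-!
# Route `PrimeLevelFamEdge`, crux K_B (stmt-Parity-20343), line `diagonal_kernel_split` rev 4, plan Ω,
# node **L7d part 2, leaf D5a′ step 3 — the `s`-TAIL of the level-innermost core is FUNDED**
# (L7D-PLAN rev 4 §3 D5a′; companion of `OffDiagCoreLevelsTrunc`, `…TruncBox`, `…TruncMono`)

`OffDiagCoreLevelsTrunc.coreWithW_eq_trunc_add_tail` writes every bounded-weight piece of the block core
(`coreWithW W G Hf Δ′`, in particular the funded large-conductor piece FL) as `coreTrunc + coreTailS`, and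
`abs_coreTailS_le` bounds the tail by a nest of nonnegative monomials. Here the nest is COUNTED at the block
top `Q = 2N` with the truncation height `tailHeight` of `OffDiagCoreLevelsTruncBox`:

* `tail_level_term_le` — one level `q ∈ [N, 2N]` of one cell and one dual modulus `h₁` costs at most
  `4π·2^{k+1}·9S_k(2N)^{10}·134(2N)^{30}·N^{−kε₀}` (`inner_tail_le_cost`, `boxSizeSnd_le_block`,
  `tailHeight_sub_one_le_block`, `norm_levelFactor_le`);
* `abs_coreTailS_block_le` — the whole nest: `(2N)^7` layers, `≤ 2N` values of `l`, `m`, `d₁`, `d₂` each,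
  `≤ 121(2N)²` near boxes, `≤ 25(2N)^{15}` dual moduli, `≤ 2N` levels:
  `|coreTailS W Sf G (2N) (coreHeight ε₀) Δ′| ≤ C_k·(2N)^{69}·N^{−kε₀}` for every weight `‖W‖ ≤ 1` and every
  `G ⊆ [N, 2N]`;
* **`coreTailS_funded`** — with `k := ⌈71/ε₀⌉₊ + 2` and `Σ_{q ∈ goodPrimes Δ′ N} ms(q) ≥ 1` eventually
  (`goodPrimes_nonempty_eventually`, `exists_qhat_rpow_le_mul_mainScaleReal`): for `0 < ε₀ ≤ 1`, every
  `Δ′ ∈ (1,2)` and `ε > 0`, eventually in `N`, UNIFORMLY in the weight `‖W‖ ≤ 1`,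
  `|coreTailS W Sf (goodPrimes Δ′ N) (2N) (coreHeight ε₀) Δ′| ≤ ε·Σ_{q ∈ goodPrimes Δ′ N} mainScaleReal Δ′ q`
  — the funded-slot shape of `OffDiagHeartCoreSplitLU.offDiagBelowSlack_io_of_coreSplit₃`.

Counting only; standard axioms. Helper toward `stub_offDiagBelowSlack_io`; closes nothing.
«The programme SEARCHES and TYPES; no claim about Landau–Siegel zeros, Theorems 1–2 of arXiv:2211.02515 or
a repaired Margin232 until a kernel theorem says so.»
-/

noncomputable section

open Finset Real Polynomial
open scoped Nat

namespace Summit.Parity.GeneralizedHardyLittlewood.Theorems.BeyondDiagonalBeatsQuarter.OffDiag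

open Literature.NumberTheory.LFunctions Literature.NumberTheory.LFunctions.KMV2000
open Literature.NumberTheory.Sieve.FriedlanderIwaniecPrimes (fourier2)
open Literature.Analysis.Calculus.WhitneyConvex (dyadicBumpBound dyadicBumpBound_nonneg)
open PeterssonSplit (nearBoxes two_pi_mul_qhat_sq qhat_sq_le)

/-! ### §1. Counting tools -/

/-- A sum of terms `≤ c` over a set of `≤ B` elements is `≤ B·c` (`c ≥ 0`). [folklore] -/
theorem sum_le_card_bound_mul {α : Type*} {s : Finset α} {f : α → ℝ} {c B : ℝ} (hc : 0 ≤ c)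
    (hf : ∀ x ∈ s, f x ≤ c) (hB : (s.card : ℝ) ≤ B) : ∑ x ∈ s, f x ≤ B * c :=
  calc ∑ x ∈ s, f x ≤ ∑ _x ∈ s, c := Finset.sum_le_sum hf
    _ = s.card * c := by rw [Finset.sum_const, nsmul_eq_mul]
    _ ≤ B * c := mul_le_mul_of_nonneg_right hB hc

/-- The Sobolev constant of the `k`-fold partial integration is nonnegative. [folklore] -/
theorem sobolevSum_nonneg (k : ℕ) :
    0 ≤ ∑ j ∈ Finset.range (k + 1), (k.choose j : ℝ) * (2 ^ j * dyadicBumpBound j) *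
      ((((k - j : ℕ) : ℝ) + 1) ^ 2 * (k - j) ! * ((k - j : ℕ) : ℝ) ^ (k - j)) :=
  Finset.sum_nonneg fun j _ ↦ by
    have := dyadicBumpBound_nonneg j
    positivity

/-- A unit of `ZMod n`, `n ≥ 2`, is not (the class of) zero. [folklore] -/
theorem ne_zero_of_isUnit_intCast {n : ℕ} (hn : 2 ≤ n) {h : ℤ} (hu : IsUnit ((h : ℤ) : ZMod n)) : h ≠ 0 := by
  rintro rfl
  haveI : Fact (1 < n) := ⟨hn⟩
  rw [Int.cast_zero, isUnit_zero_iff] at hu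
  exact zero_ne_one hu

/-! ### §2. One level of one cell and one dual modulus -/

section Block

variable {N : ℕ}

open Classical in
/-- **One level term of the tail nest.** For `1 ≤ N ≤ q ≤ 2N`, `2N ≥ 40`, `0 < Δ′ ≤ 2`, `0 ≤ ε₀ ≤ 1`, a cell of the
nest at `2N`, a dual modulus `|h₁| ≤ 12(2N)^{15}` and `k ≥ 2`:
`𝟙[h₁ unit mod q(r+1)]·‖level factor‖·(inner s-tail at tailHeight) ≤ 4π·2^{k+1}·9S_k(2N)^{10}·134(2N)^{30}·N^{−kε₀}`.
[cite: KowalskiMichelVanderKam2000, Lemma 3.3 p. 9, §6 p. 19 — derivation] -/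
theorem tail_level_term_le (hN : 1 ≤ N) {q : ℕ} (hNq : N ≤ q) (hq2 : q ≤ 2 * N) (hP : 40 ≤ 2 * N) (hq : 40 ≤ q)
    {Δ' : ℝ} (h0 : 0 < Δ') (h2 : Δ' ≤ 2) {ε₀ : ℝ} (hε₀ : 0 ≤ ε₀) (hε₁ : ε₀ ≤ 1) {r l m d₁ d₂ : ℕ} {i : ℕ × ℕ}
    (hl : l ∈ Finset.Icc 1 ⌊qhat (2 * N) ^ Δ'⌋₊) (hm : m ∈ Finset.Icc 1 ⌊qhat (2 * N) ^ Δ'⌋₊)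
    (hd₁ : d₁ ∈ l.divisors) (hd₂ : d₂ ∈ m.divisors) (hi : i ∈ nearBoxes (2 * N) d₁ d₂ (Real.log (2 * N : ℕ) ^ 4))
    {h₁ : ℤ} (hh : |(h₁ : ℝ)| ≤ 12 * (2 * (N : ℝ)) ^ 15) {k : ℕ} (hk : 2 ≤ k) :
    (if IsUnit ((h₁ : ℤ) : ZMod (q * (r + 1))) then
      ‖(if r < q ^ 7 ∧ l ≤ ⌊qhat q ^ Δ'⌋₊ ∧ m ≤ ⌊qhat q ^ Δ'⌋₊ ∧ i ∈ nearBoxes q d₁ d₂ (Real.log q ^ 4) then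
          2 * (qhat q : ℂ) * (2 * π / q) *
            (((mollifierCoeff (X ^ 2) (qhat q ^ Δ') l * mollifierCoeff (X ^ 2) (qhat q ^ Δ') m : ℝ) : ℂ))
        else 0)‖ *
      ∑' s : ℤ, (if (tailHeight ε₀ N r l m d₁ d₂ i h₁ : ℝ) <
          |(s : ℝ) + ((((l / d₁ : ℕ) : ℤ) * (m / d₂ : ℕ) : ℤ) : ℝ) / ((q * (r + 1) : ℕ) : ℝ)| then
        ‖fourier2 (boxWeight q d₁ d₂ (l / d₁) (m / d₂) (r + 1) i) (h₁ / (q * (r + 1) : ℕ))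
          ((s : ℝ) / h₁ + (((l / d₁ : ℕ) : ℤ) * (m / d₂ : ℕ) : ℝ) / ((h₁ : ℝ) * (q * (r + 1) : ℕ)))‖ else 0)
      else 0) ≤
      4 * π * (2 ^ (k + 1) * (9 * (∑ j ∈ Finset.range (k + 1), (k.choose j : ℝ) * (2 ^ j * dyadicBumpBound j) *
          ((((k - j : ℕ) : ℝ) + 1) ^ 2 * (k - j) ! * ((k - j : ℕ) : ℝ) ^ (k - j))) * (2 * (N : ℝ)) ^ 10) *
        (134 * (2 * (N : ℝ)) ^ 30) * (((N : ℝ) ^ ε₀) ^ k)⁻¹) := by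
  have hS0 := sobolevSum_nonneg k
  have hN1 : (1 : ℝ) ≤ N := by exact_mod_cast hN
  have hRHS : 0 ≤ 4 * π * (2 ^ (k + 1) * (9 * (∑ j ∈ Finset.range (k + 1), (k.choose j : ℝ) *
      (2 ^ j * dyadicBumpBound j) * ((((k - j : ℕ) : ℝ) + 1) ^ 2 * (k - j) ! * ((k - j : ℕ) : ℝ) ^ (k - j))) *
      (2 * (N : ℝ)) ^ 10) * (134 * (2 * (N : ℝ)) ^ 30) * (((N : ℝ) ^ ε₀) ^ k)⁻¹) := by positivity
  by_cases hu : IsUnit ((h₁ : ℤ) : ZMod (q * (r + 1)))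
  swap
  · rw [if_neg hu]; exact hRHS
  rw [if_pos hu]
  haveI : NeZero q := ⟨by omega⟩
  have hqc : 2 ≤ q * (r + 1) := le_trans (by omega) (Nat.le_mul_of_pos_right q (Nat.succ_pos r))
  have hh₁ : h₁ ≠ 0 := ne_zero_of_isUnit_intCast hqc hu
  have hd₁1 := Nat.pos_of_mem_divisors hd₁
  have hd₂1 := Nat.pos_of_mem_divisors hd₂
  have hl1 := (Finset.mem_Icc.mp hl).1
  have hm1 := (Finset.mem_Icc.mp hm).1
  have ha : 1 ≤ l / d₁ := Nat.div_pos (Nat.le_of_dvd (by omega) (Nat.dvd_of_mem_divisors hd₁)) hd₁1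
  have hb : 1 ≤ m / d₂ := Nat.div_pos (Nat.le_of_dvd (by omega) (Nat.dvd_of_mem_divisors hd₂)) hd₂1
  have hF := norm_levelFactor_le (q := q) hq h0 (r := r) hl1 hm1 d₁ d₂ i
  have hI := inner_tail_le_cost hN hNq hq2 hd₁1 hd₂1 ha hb i hh₁ hε₀ hk (r := r) (l := l) (m := m)
  have hS₂ := boxSizeSnd_le_block hP hd₁1 hd₂1 hi k (r := r)
  have hT := tailHeight_sub_one_le_block (r := r) hN hP h0 h2 hε₁ hl hm hd₁ hd₂ hi hh (ε₀ := ε₀)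
  -- `N^{ε₀ k} ≤ q^{ε₀ k}`
  have hNq' : (N : ℝ) ≤ q := by exact_mod_cast hNq
  have hN0 : (0 : ℝ) ≤ N := by positivity
  have hpow : ((N : ℝ) ^ ε₀) ^ k ≤ ((q : ℝ) ^ ε₀) ^ k :=
    pow_le_pow_left₀ (by positivity) (Real.rpow_le_rpow hN0 hNq' hε₀) k
  have hNpos : 0 < ((N : ℝ) ^ ε₀) ^ k := by positivity
  have hinv : (((q : ℝ) ^ ε₀) ^ k)⁻¹ ≤ (((N : ℝ) ^ ε₀) ^ k)⁻¹ := inv_anti₀ hNpos hpow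
  have hinner0 : 0 ≤ ∑' s : ℤ, (if (tailHeight ε₀ N r l m d₁ d₂ i h₁ : ℝ) <
      |(s : ℝ) + ((((l / d₁ : ℕ) : ℤ) * (m / d₂ : ℕ) : ℤ) : ℝ) / ((q * (r + 1) : ℕ) : ℝ)| then
      ‖fourier2 (boxWeight q d₁ d₂ (l / d₁) (m / d₂) (r + 1) i) (h₁ / (q * (r + 1) : ℕ))
        ((s : ℝ) / h₁ + (((l / d₁ : ℕ) : ℤ) * (m / d₂ : ℕ) : ℝ) / ((h₁ : ℝ) * (q * (r + 1) : ℕ)))‖ else 0) :=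
    tsum_nonneg fun s ↦ by split_ifs <;> positivity
  have hT0 : (0 : ℝ) ≤ ((tailHeight ε₀ N r l m d₁ d₂ i h₁ - 1 : ℕ) : ℝ) := by positivity
  have hq0 : (0 : ℝ) ≤ (((q : ℝ) ^ ε₀) ^ k)⁻¹ := by positivity
  have hS₂0 : 0 ≤ (3 * 2 ^ i.1 / 2) * (3 * 2 ^ i.2 / 2) *
      (∑ j ∈ Finset.range (k + 1), (k.choose j : ℝ) * (2 ^ j * dyadicBumpBound j) *
        ((((k - j : ℕ) : ℝ) + 1) ^ 2 * (k - j) ! * ((k - j : ℕ) : ℝ) ^ (k - j))) *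
      (((d₂ : ℝ) * d₁ * (2 ^ i.1 / 2)) ^ (-(1 : ℝ) / 2) * ((r + 1 : ℕ) : ℝ)⁻¹ * ((2 : ℝ) ^ i.2 / 2) ^ (-(1 : ℝ) / 2)) := by
    positivity
  calc _ ≤ (4 * π) * (2 ^ (k + 1) * ((3 * 2 ^ i.1 / 2) * (3 * 2 ^ i.2 / 2) *
        (∑ j ∈ Finset.range (k + 1), (k.choose j : ℝ) * (2 ^ j * dyadicBumpBound j) *
          ((((k - j : ℕ) : ℝ) + 1) ^ 2 * (k - j) ! * ((k - j : ℕ) : ℝ) ^ (k - j))) *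
        (((d₂ : ℝ) * d₁ * (2 ^ i.1 / 2)) ^ (-(1 : ℝ) / 2) * ((r + 1 : ℕ) : ℝ)⁻¹ * ((2 : ℝ) ^ i.2 / 2) ^ (-(1 : ℝ) / 2))) *
        ((tailHeight ε₀ N r l m d₁ d₂ i h₁ - 1 : ℕ) : ℝ) * (((q : ℝ) ^ ε₀) ^ k)⁻¹) :=
        mul_le_mul hF hI hinner0 (by positivity)
    _ ≤ (4 * π) * (2 ^ (k + 1) * (9 * (∑ j ∈ Finset.range (k + 1), (k.choose j : ℝ) * (2 ^ j * dyadicBumpBound j) *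
          ((((k - j : ℕ) : ℝ) + 1) ^ 2 * (k - j) ! * ((k - j : ℕ) : ℝ) ^ (k - j))) * (2 * (N : ℝ)) ^ 10) *
        (134 * (2 * (N : ℝ)) ^ 30) * (((N : ℝ) ^ ε₀) ^ k)⁻¹) := by
        gcongr

/-- **The dual-modulus range of a cell is a block monomial**: for `G ⊆ [N, 2N]` the family height
`H* = sup_{q∈G} coreHeight ε₀ q …` of a cell of the nest at `2N` has `#[−H*, H*] ≤ 25·(2N)^{15}` and every
`h₁` in it has `|h₁| ≤ 12(2N)^{15}`. [cite: KowalskiMichelVanderKam2000, Lemma 3.3 p. 9 — derivation] -/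
theorem sup_coreHeight_le_block (hN : 1 ≤ N) (hP : 40 ≤ 2 * N) {G : Finset ℕ} (hG : ∀ q ∈ G, N ≤ q ∧ q ≤ 2 * N)
    {Δ' : ℝ} (h0 : 0 < Δ') (h2 : Δ' ≤ 2) {ε₀ : ℝ} (hε₁ : ε₀ ≤ 1) {r l m d₁ d₂ : ℕ} {i : ℕ × ℕ}
    (hr : r ∈ Finset.range ((2 * N) ^ 7)) (hl : l ∈ Finset.Icc 1 ⌊qhat (2 * N) ^ Δ'⌋₊)
    (hm : m ∈ Finset.Icc 1 ⌊qhat (2 * N) ^ Δ'⌋₊) (hd₁ : d₁ ∈ l.divisors) (hd₂ : d₂ ∈ m.divisors)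
    (hi : i ∈ nearBoxes (2 * N) d₁ d₂ (Real.log (2 * N : ℕ) ^ 4)) :
    ((G.sup (fun q ↦ coreHeight ε₀ q d₁ d₂ (l / d₁) (m / d₂) (r + 1) i) : ℕ) : ℝ) ≤ 12 * (2 * (N : ℝ)) ^ 15 := by
  have hnat : G.sup (fun q ↦ coreHeight ε₀ q d₁ d₂ (l / d₁) (m / d₂) (r + 1) i) ≤ 12 * (2 * N) ^ 15 := by
    refine Finset.sup_le fun q hq ↦ ?_
    have h := coreHeight_le_block hN (hG q hq).1 (hG q hq).2 hP h0 h2 hε₁ hr hl hm hd₁ hd₂ hi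
    exact_mod_cast h
  exact_mod_cast hnat

/-- `#[−H, H] = 2H + 1 ≤ 25(2N)^{15}` for `H ≤ 12(2N)^{15}`, `N ≥ 1`. [folklore] -/
theorem card_Icc_neg_le_block (hN : 1 ≤ N) {H : ℕ} (hH : (H : ℝ) ≤ 12 * (2 * (N : ℝ)) ^ 15) :
    ((Finset.Icc (-(H : ℤ)) (H : ℤ)).card : ℝ) ≤ 25 * (2 * (N : ℝ)) ^ 15 := by
  rw [Int.card_Icc]
  have h1 : ((H : ℤ) + 1 - -(H : ℤ)).toNat = 2 * H + 1 := by omega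
  rw [h1]
  push_cast
  have hN1 : (1 : ℝ) ≤ N := by exact_mod_cast hN
  have : (1 : ℝ) ≤ (2 * (N : ℝ)) ^ 15 := one_le_pow₀ (by linarith)
  linarith

open Classical in
/-- **One cell of the tail nest**: summing `tail_level_term_le` over the dual moduli `h₁ ∈ [−H*, H*]`
(`≤ 25(2N)^{15}` of them) and the levels `q ∈ G ⊆ [N, 2N] ∩ [40, ∞)` (`≤ 2N` of them).
[cite: KowalskiMichelVanderKam2000, Lemma 3.3 p. 9, §6 p. 19 — derivation] -/
theorem tail_cell_le (hN : 1 ≤ N) (hP : 40 ≤ 2 * N) {G : Finset ℕ} (hG : ∀ q ∈ G, N ≤ q ∧ q ≤ 2 * N ∧ 40 ≤ q)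
    {Δ' : ℝ} (h0 : 0 < Δ') (h2 : Δ' ≤ 2) {ε₀ : ℝ} (hε₀ : 0 ≤ ε₀) (hε₁ : ε₀ ≤ 1) {r l m d₁ d₂ : ℕ} {i : ℕ × ℕ}
    (hr : r ∈ Finset.range ((2 * N) ^ 7)) (hl : l ∈ Finset.Icc 1 ⌊qhat (2 * N) ^ Δ'⌋₊)
    (hm : m ∈ Finset.Icc 1 ⌊qhat (2 * N) ^ Δ'⌋₊) (hd₁ : d₁ ∈ l.divisors) (hd₂ : d₂ ∈ m.divisors)
    (hi : i ∈ nearBoxes (2 * N) d₁ d₂ (Real.log (2 * N : ℕ) ^ 4)) {k : ℕ} (hk : 2 ≤ k) :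
    ∑ h₁ ∈ Icc (-((G.sup (fun q ↦ coreHeight ε₀ q d₁ d₂ (l / d₁) (m / d₂) (r + 1) i) : ℕ) : ℤ))
        ((G.sup (fun q ↦ coreHeight ε₀ q d₁ d₂ (l / d₁) (m / d₂) (r + 1) i) : ℕ) : ℤ),
      ∑ q ∈ G, (if IsUnit ((h₁ : ℤ) : ZMod (q * (r + 1))) then
        ‖(if r < q ^ 7 ∧ l ≤ ⌊qhat q ^ Δ'⌋₊ ∧ m ≤ ⌊qhat q ^ Δ'⌋₊ ∧ i ∈ nearBoxes q d₁ d₂ (Real.log q ^ 4) then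
            2 * (qhat q : ℂ) * (2 * π / q) *
              (((mollifierCoeff (X ^ 2) (qhat q ^ Δ') l * mollifierCoeff (X ^ 2) (qhat q ^ Δ') m : ℝ) : ℂ))
          else 0)‖ *
        ∑' s : ℤ, (if (tailHeight ε₀ N r l m d₁ d₂ i h₁ : ℝ) <
            |(s : ℝ) + ((((l / d₁ : ℕ) : ℤ) * (m / d₂ : ℕ) : ℤ) : ℝ) / ((q * (r + 1) : ℕ) : ℝ)| then
          ‖fourier2 (boxWeight q d₁ d₂ (l / d₁) (m / d₂) (r + 1) i) (h₁ / (q * (r + 1) : ℕ))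
            ((s : ℝ) / h₁ + (((l / d₁ : ℕ) : ℤ) * (m / d₂ : ℕ) : ℝ) / ((h₁ : ℝ) * (q * (r + 1) : ℕ)))‖ else 0)
        else 0) ≤
      25 * (2 * (N : ℝ)) ^ 15 * (2 * (N : ℝ) *
        (4 * π * (2 ^ (k + 1) * (9 * (∑ j ∈ Finset.range (k + 1), (k.choose j : ℝ) * (2 ^ j * dyadicBumpBound j) *
          ((((k - j : ℕ) : ℝ) + 1) ^ 2 * (k - j) ! * ((k - j : ℕ) : ℝ) ^ (k - j))) * (2 * (N : ℝ)) ^ 10) *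
        (134 * (2 * (N : ℝ)) ^ 30) * (((N : ℝ) ^ ε₀) ^ k)⁻¹))) := by
  have hS0 := sobolevSum_nonneg k
  have hB0 : 0 ≤ 4 * π * (2 ^ (k + 1) * (9 * (∑ j ∈ Finset.range (k + 1), (k.choose j : ℝ) *
      (2 ^ j * dyadicBumpBound j) * ((((k - j : ℕ) : ℝ) + 1) ^ 2 * (k - j) ! * ((k - j : ℕ) : ℝ) ^ (k - j))) *
      (2 * (N : ℝ)) ^ 10) * (134 * (2 * (N : ℝ)) ^ 30) * (((N : ℝ) ^ ε₀) ^ k)⁻¹) := by positivity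
  have hG' : ∀ q ∈ G, N ≤ q ∧ q ≤ 2 * N := fun q hq ↦ ⟨(hG q hq).1, (hG q hq).2.1⟩
  have hH := sup_coreHeight_le_block hN hP hG' h0 h2 hε₁ hr hl hm hd₁ hd₂ hi
  have hGcard : (G.card : ℝ) ≤ 2 * (N : ℝ) := by
    have hsub : G ⊆ Finset.Icc N (2 * N) := fun q hq ↦ Finset.mem_Icc.mpr (hG' q hq)
    have h1 := Finset.card_le_card hsub
    rw [Nat.card_Icc] at h1
    have h2 : (G.card : ℝ) ≤ ((2 * N + 1 - N : ℕ) : ℝ) := by exact_mod_cast h1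
    have h3 : ((2 * N + 1 - N : ℕ) : ℝ) = N + 1 := by
      rw [show 2 * N + 1 - N = N + 1 by omega]; push_cast; ring
    have hN1 : (1 : ℝ) ≤ N := by exact_mod_cast hN
    linarith
  refine sum_le_card_bound_mul (by positivity) (fun h₁ hh₁ ↦ ?_) (card_Icc_neg_le_block hN hH)
  have hh : |(h₁ : ℝ)| ≤ 12 * (2 * (N : ℝ)) ^ 15 := by
    have hmem := Finset.mem_Icc.mp hh₁
    have habs : |h₁| ≤ ((G.sup (fun q ↦ coreHeight ε₀ q d₁ d₂ (l / d₁) (m / d₂) (r + 1) i) : ℕ) : ℤ) :=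
      abs_le.mpr hmem
    have habs' : |(h₁ : ℝ)| ≤ ((G.sup (fun q ↦ coreHeight ε₀ q d₁ d₂ (l / d₁) (m / d₂) (r + 1) i) : ℕ) : ℝ) := by
      rw [← Int.cast_abs]; exact_mod_cast habs
    exact habs'.trans hH
  refine sum_le_card_bound_mul hB0 (fun q hq ↦ ?_) hGcard
  obtain ⟨hNq, hq2, hq⟩ := hG q hq
  exact tail_level_term_le hN hNq hq2 hP hq h0 h2 hε₀ hε₁ hl hm hd₁ hd₂ hi hh hk

/-! ### §3. The whole nest -/

/-- `121·(log 2N)² ≤ 121·(2N)²`. [folklore] -/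
theorem log_sq_le_block (N : ℕ) : 121 * Real.log ((2 * N : ℕ) : ℝ) ^ 2 ≤ 121 * (2 * (N : ℝ)) ^ 2 := by
  have h0 : (0 : ℝ) ≤ ((2 * N : ℕ) : ℝ) := by positivity
  have h1 : Real.log ((2 * N : ℕ) : ℝ) ≤ ((2 * N : ℕ) : ℝ) := Real.log_le_self h0
  have h2 : 0 ≤ Real.log ((2 * N : ℕ) : ℝ) := Real.log_natCast_nonneg _
  have h3 : ((2 * N : ℕ) : ℝ) = 2 * (N : ℝ) := by push_cast; ring
  rw [← h3]
  gcongr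

open Classical in
/-- **The `s`-tail of the level-innermost core is a block monomial times `N^{−kε₀}`.** For a weight `‖W‖ ≤ 1`,
levels `G ⊆ [N, 2N] ∩ [40, ∞)` (`N ≥ 1`, `2N ≥ 40`), `0 < Δ′ ≤ 2`, `0 ≤ ε₀ ≤ 1` and `k ≥ 2`, at the truncation
`Sf = tailHeight + ⌈|ab/(N(r+1))|⌉`:
`|coreTailS W Sf G (2N) (coreHeight ε₀) Δ′| ≤ (2N)^7·2N·2N·2N·2N·121(2N)²·(25(2N)^{15}·2N·4π·2^{k+1}·9S_k(2N)^{10}·134(2N)^{30}·N^{−kε₀})`.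
[cite: KowalskiMichelVanderKam2000, Lemma 3.3 p. 9, §6 p. 19 — derivation] -/
theorem abs_coreTailS_block_le {W : ℕ → ℕ → ℕ → ℕ → ℕ → ℕ → ℕ × ℕ → ℤ → ℤ → ℂ}
    (hW : ∀ q r l m d₁ d₂ i h₁ s, ‖W q r l m d₁ d₂ i h₁ s‖ ≤ 1) (hN : 1 ≤ N) (hP : 40 ≤ 2 * N)
    (G : Finset ℕ) (hG : ∀ q ∈ G, N ≤ q ∧ q ≤ 2 * N ∧ 40 ≤ q) {Δ' : ℝ} (h0 : 0 < Δ') (h2 : Δ' ≤ 2)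
    {ε₀ : ℝ} (hε₀ : 0 ≤ ε₀) (hε₁ : ε₀ ≤ 1) {k : ℕ} (hk : 2 ≤ k) :
    |coreTailS W (fun r l m d₁ d₂ i h₁ ↦ tailHeight ε₀ N r l m d₁ d₂ i h₁ +
        ⌈|((((l / d₁ : ℕ) : ℤ) * (m / d₂ : ℕ) : ℤ) : ℝ) / ((N : ℝ) * ((r + 1 : ℕ) : ℝ))|⌉₊) G (2 * N) (coreHeight ε₀) Δ'| ≤
      (2 * (N : ℝ)) ^ 7 * (2 * (N : ℝ) * (2 * (N : ℝ) * (2 * (N : ℝ) * (2 * (N : ℝ) * (121 * (2 * (N : ℝ)) ^ 2 *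
        (25 * (2 * (N : ℝ)) ^ 15 * (2 * (N : ℝ) *
          (4 * π * (2 ^ (k + 1) * (9 * (∑ j ∈ Finset.range (k + 1), (k.choose j : ℝ) * (2 ^ j * dyadicBumpBound j) *
            ((((k - j : ℕ) : ℝ) + 1) ^ 2 * (k - j) ! * ((k - j : ℕ) : ℝ) ^ (k - j))) * (2 * (N : ℝ)) ^ 10) *
          (134 * (2 * (N : ℝ)) ^ 30) * (((N : ℝ) ^ ε₀) ^ k)⁻¹))))))))) := by
  have hS0 := sobolevSum_nonneg k
  set B : ℝ := 25 * (2 * (N : ℝ)) ^ 15 * (2 * (N : ℝ) *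
    (4 * π * (2 ^ (k + 1) * (9 * (∑ j ∈ Finset.range (k + 1), (k.choose j : ℝ) * (2 ^ j * dyadicBumpBound j) *
      ((((k - j : ℕ) : ℝ) + 1) ^ 2 * (k - j) ! * ((k - j : ℕ) : ℝ) ^ (k - j))) * (2 * (N : ℝ)) ^ 10) *
    (134 * (2 * (N : ℝ)) ^ 30) * (((N : ℝ) ^ ε₀) ^ k)⁻¹))) with hB
  have hB0 : 0 ≤ B := by positivity
  have hN1 : (1 : ℝ) ≤ N := by exact_mod_cast hN
  have hN0 : (0 : ℝ) ≤ 2 * (N : ℝ) := by positivity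
  have hG2 : ∀ q ∈ G, 2 ≤ q ∧ N ≤ q := fun q hq ↦ ⟨le_trans (by norm_num) (hG q hq).2.2, (hG q hq).1⟩
  refine (abs_coreTailS_le hW (tailHeight ε₀ N) G hN hG2 (coreHeight ε₀) Δ').trans ?_
  have hL : (⌊qhat (2 * N) ^ Δ'⌋₊ : ℝ) ≤ 2 * (N : ℝ) := by
    have := floor_qhat_rpow_le_self hP h0 h2; exact_mod_cast this
  have hcardL : ((Finset.Icc 1 ⌊qhat (2 * N) ^ Δ'⌋₊).card : ℝ) ≤ 2 * (N : ℝ) := by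
    rw [Nat.card_Icc]; simpa using hL
  have hcardR : ((Finset.range ((2 * N) ^ 7)).card : ℝ) ≤ (2 * (N : ℝ)) ^ 7 := by
    rw [Finset.card_range]; push_cast; exact le_rfl
  have hdiv : ∀ l ∈ Finset.Icc 1 ⌊qhat (2 * N) ^ Δ'⌋₊, ((l.divisors).card : ℝ) ≤ 2 * (N : ℝ) := by
    intro l hl
    have h1 : (l.divisors.card : ℝ) ≤ l := by exact_mod_cast Nat.card_divisors_le_self l
    have h2 : (l : ℝ) ≤ ⌊qhat (2 * N) ^ Δ'⌋₊ := by exact_mod_cast (Finset.mem_Icc.mp hl).2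
    linarith
  refine sum_le_card_bound_mul (by positivity) (fun r hr ↦ ?_) hcardR
  refine sum_le_card_bound_mul (by positivity) (fun l hl ↦ ?_) hcardL
  refine sum_le_card_bound_mul (by positivity) (fun m hm ↦ ?_) hcardL
  refine sum_le_card_bound_mul (by positivity) (fun d₁ hd₁ ↦ ?_) (hdiv l hl)
  refine sum_le_card_bound_mul (by positivity) (fun d₂ hd₂ ↦ ?_) (hdiv m hm)
  have hd₁1 := Nat.pos_of_mem_divisors hd₁
  have hd₂1 := Nat.pos_of_mem_divisors hd₂
  have hnb : ((nearBoxes (2 * N) d₁ d₂ (Real.log ((2 * N : ℕ) : ℝ) ^ 4)).card : ℝ) ≤ 121 * (2 * (N : ℝ)) ^ 2 :=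
    (card_nearBoxes_scales_le (q := 2 * N) hP (Nat.mul_pos hd₁1 hd₂1)).trans (log_sq_le_block N)
  refine sum_le_card_bound_mul hB0 (fun i hi ↦ ?_) hnb
  by_cases hcop : Nat.Coprime (l / d₁) (r + 1)
  swap
  · rw [if_neg hcop]; exact hB0
  rw [if_pos hcop, hB]
  exact tail_cell_le hN hP hG h0 h2 hε₀ hε₁ hr hl hm hd₁ hd₂ hi hk

/-! ### §4. The tail is funded -/

/-- The block monomial of `abs_coreTailS_block_le`, collected: it equals `K_k·2^{69}·N^{69}·N^{−kε₀}` with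
`K_k = 121·25·4π·2^{k+1}·9·134·S_k`. [folklore] -/
theorem block_monomial_eq (N : ℕ) (ε₀ : ℝ) (k : ℕ) (S : ℝ) :
    (2 * (N : ℝ)) ^ 7 * (2 * (N : ℝ) * (2 * (N : ℝ) * (2 * (N : ℝ) * (2 * (N : ℝ) * (121 * (2 * (N : ℝ)) ^ 2 *
        (25 * (2 * (N : ℝ)) ^ 15 * (2 * (N : ℝ) *
          (4 * π * (2 ^ (k + 1) * (9 * S * (2 * (N : ℝ)) ^ 10) *
          (134 * (2 * (N : ℝ)) ^ 30) * (((N : ℝ) ^ ε₀) ^ k)⁻¹))))))))) =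
      (121 * 25 * (4 * π) * 2 ^ (k + 1) * 9 * 134 * S) * 2 ^ 69 * (N : ℝ) ^ 69 * (((N : ℝ) ^ ε₀) ^ k)⁻¹ := by
  ring

/-- For `N ≥ 1` and `k·ε₀ ≥ 71`: `N^{69}·N^{−kε₀} ≤ N^{−2}`. [folklore] -/
theorem pow_mul_rpow_inv_le {N : ℕ} (hN : 1 ≤ N) {ε₀ : ℝ} {k : ℕ} (hk : 71 ≤ (k : ℝ) * ε₀) :
    (N : ℝ) ^ 69 * (((N : ℝ) ^ ε₀) ^ k)⁻¹ ≤ (N : ℝ) ^ (-(2 : ℝ)) := by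
  have hN1 : (1 : ℝ) ≤ N := by exact_mod_cast hN
  have hN0 : (0 : ℝ) < N := by linarith
  rw [← Real.rpow_natCast ((N : ℝ) ^ ε₀) k, ← Real.rpow_mul hN0.le, ← Real.rpow_neg hN0.le,
    ← Real.rpow_natCast (N : ℝ) 69, ← Real.rpow_add hN0]
  refine Real.rpow_le_rpow_of_exponent_le hN1 ?_
  push_cast
  linarith

/-- Eventually `Σ_{q ∈ goodPrimes Δ′ N} mainScaleReal Δ′ q ≥ 1` (`0 < Δ′ < 2`): the block has a good prime and
`ms(q) ≥ q̂^{3/5} ≥ 1` for large `q`. [cite: KowalskiMichelVanderKam2000, §6 p. 19 — derivation] -/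
theorem one_le_sum_mainScaleReal_eventually {Δ' : ℝ} (h0 : 0 < Δ') (h2 : Δ' < 2) :
    ∃ N₀ : ℕ, ∀ N : ℕ, N₀ ≤ N → 1 ≤ ∑ q ∈ goodPrimes Δ' N, mainScaleReal Δ' q := by
  obtain ⟨N₁, hN₁⟩ := goodPrimes_nonempty_eventually h0 h2
  obtain ⟨q₀, hq₀⟩ := PeterssonSplit.exists_qhat_rpow_le_mul_mainScaleReal (K := 1) (ε := 1) zero_le_one zero_lt_one
  refine ⟨max (max N₁ q₀) 40, fun N hN ↦ ?_⟩
  have hNN₁ : N₁ ≤ N := le_trans (le_trans (le_max_left _ _) (le_max_left _ _)) hN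
  have hNq₀ : q₀ ≤ N := le_trans (le_trans (le_max_right _ _) (le_max_left _ _)) hN
  have hN40 : 40 ≤ N := le_trans (le_max_right _ _) hN
  obtain ⟨q, hq⟩ := hN₁ N hNN₁
  obtain ⟨hqN, -, -, -⟩ := KMV2000.mem_goodPrimes_iff.mp hq
  have hq40 : 40 ≤ q := by omega
  have hms : 1 ≤ mainScaleReal Δ' q := by
    have h := hq₀ q (by omega) Δ' h0 h2.le
    rw [one_mul, one_mul] at h
    exact le_trans (Real.one_le_rpow (one_lt_qhat hq40).le (by norm_num)) h
  exact hms.trans (Finset.single_le_sum (fun q _ ↦ mainScaleReal_nonneg Δ' q) hq)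

/-- **D5a′: the `s`-tail of the level-innermost block core is FUNDED.** For `0 < ε₀ ≤ 1`: for every `Δ′ ∈ (1,2)`
and `ε > 0` there is `N₀` such that for all `N ≥ N₀` and EVERY weight `‖W‖ ≤ 1`,
`|coreTailS W (tailHeight ε₀ N + ⌈|ab/(N(r+1))|⌉) (goodPrimes Δ′ N) (2N) (coreHeight ε₀) Δ′| ≤ ε·Σ_{q ∈ goodPrimes Δ′ N} ms(q)`
— the funded-slot shape of `offDiagBelowSlack_io_of_coreSplit₃`, uniformly in the (selector × kernel) weight.
[cite: KowalskiMichelVanderKam2000, Lemma 3.3 p. 9, §6 p. 19 — derivation] -/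
theorem coreTailS_funded {ε₀ : ℝ} (hε₀ : 0 < ε₀) (hε₁ : ε₀ ≤ 1) :
    ∀ Δ' : ℝ, 1 < Δ' → Δ' < 2 → ∀ ε : ℝ, 0 < ε → ∃ N₀ : ℕ, ∀ N : ℕ, N₀ ≤ N →
      ∀ W : ℕ → ℕ → ℕ → ℕ → ℕ → ℕ → ℕ × ℕ → ℤ → ℤ → ℂ, (∀ q r l m d₁ d₂ i h₁ s, ‖W q r l m d₁ d₂ i h₁ s‖ ≤ 1) →
        |coreTailS W (fun r l m d₁ d₂ i h₁ ↦ tailHeight ε₀ N r l m d₁ d₂ i h₁ +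
            ⌈|((((l / d₁ : ℕ) : ℤ) * (m / d₂ : ℕ) : ℤ) : ℝ) / ((N : ℝ) * ((r + 1 : ℕ) : ℝ))|⌉₊)
          (goodPrimes Δ' N) (2 * N) (coreHeight ε₀) Δ'| ≤ ε * ∑ q ∈ goodPrimes Δ' N, mainScaleReal Δ' q := by
  -- the order of partial integration
  set k : ℕ := ⌈71 / ε₀⌉₊ + 2 with hk
  have hk2 : 2 ≤ k := by omega
  have hkε : 71 ≤ (k : ℝ) * ε₀ := by
    have h1 : (71 / ε₀ : ℝ) ≤ ⌈71 / ε₀⌉₊ := Nat.le_ceil _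
    have h2 : (k : ℝ) = (⌈71 / ε₀⌉₊ : ℝ) + 2 := by rw [hk]; push_cast; ring
    rw [h2]
    have h3 : 71 = 71 / ε₀ * ε₀ := by field_simp
    nlinarith
  set S : ℝ := ∑ j ∈ Finset.range (k + 1), (k.choose j : ℝ) * (2 ^ j * dyadicBumpBound j) *
    ((((k - j : ℕ) : ℝ) + 1) ^ 2 * (k - j) ! * ((k - j : ℕ) : ℝ) ^ (k - j)) with hS
  have hS0 : 0 ≤ S := sobolevSum_nonneg k
  set K : ℝ := 121 * 25 * (4 * π) * 2 ^ (k + 1) * 9 * 134 * S with hK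
  have hK0 : 0 ≤ K := by positivity
  -- the monomial bound as a function of `(Δ′, N)` alone
  have hfund := funded_of_rpow_log_saving (fun _ N ↦ K * 2 ^ 69 * (N : ℝ) ^ 69 * (((N : ℝ) ^ ε₀) ^ k)⁻¹)
    (fun Δ' h1 h2 ↦ by
      obtain ⟨N₁, hN₁⟩ := one_le_sum_mainScaleReal_eventually (by linarith) h2
      refine ⟨2, two_pos, 0, K * 2 ^ 69, max N₁ 1, fun N hN ↦ ?_⟩
      have hNN₁ : N₁ ≤ N := le_trans (le_max_left _ _) hN
      have hN1 : 1 ≤ N := le_trans (le_max_right _ _) hN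
      have hms := hN₁ N hNN₁
      have hmono := pow_mul_rpow_inv_le hN1 hkε
      have hr0 : 0 ≤ (N : ℝ) ^ (-(2 : ℝ)) := by positivity
      calc K * 2 ^ 69 * (N : ℝ) ^ 69 * (((N : ℝ) ^ ε₀) ^ k)⁻¹
          = K * 2 ^ 69 * ((N : ℝ) ^ 69 * (((N : ℝ) ^ ε₀) ^ k)⁻¹) := by ring
        _ ≤ K * 2 ^ 69 * (N : ℝ) ^ (-(2 : ℝ)) := by gcongr
        _ = K * 2 ^ 69 * Real.log N ^ 0 * (N : ℝ) ^ (-(2 : ℝ)) * 1 := by rw [pow_zero]; ring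
        _ ≤ K * 2 ^ 69 * Real.log N ^ 0 * (N : ℝ) ^ (-(2 : ℝ)) * ∑ q ∈ goodPrimes Δ' N, mainScaleReal Δ' q := by
            gcongr)
  intro Δ' h1 h2 ε hε
  obtain ⟨N₀, hN₀⟩ := hfund Δ' h1 h2 ε hε
  refine ⟨max N₀ 40, fun N hN W hW ↦ ?_⟩
  have hNN₀ : N₀ ≤ N := le_trans (le_max_left _ _) hN
  have hN20 : 40 ≤ N := le_trans (le_max_right _ _) hN
  have hP : 40 ≤ 2 * N := by omega
  have hG : ∀ q ∈ goodPrimes Δ' N, N ≤ q ∧ q ≤ 2 * N ∧ 40 ≤ q := by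
    intro q hq
    obtain ⟨hqN, hq2, -, -⟩ := KMV2000.mem_goodPrimes_iff.mp hq
    exact ⟨by omega, hq2, by omega⟩
  have hmain := abs_coreTailS_block_le hW (by omega) hP (goodPrimes Δ' N) hG (by linarith) h2.le hε₀.le hε₁ hk2
  rw [block_monomial_eq] at hmain
  refine hmain.trans (le_trans (le_of_eq ?_) (hN₀ N hNN₀))
  simp only [hK]
  ring

end Block

end Summit.Parity.GeneralizedHardyLittlewood.Theorems.BeyondDiagonalBeatsQuarter.OffDiag
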